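import Summits.BirchSwinnertonDyer.BirchSwinnertonDyer.Theorems.ManinLocalTwoThreeManinConstantTwoHundredEightB
import Summits.BirchSwinnertonDyer.BirchSwinnertonDyer.Theorems.ManinLocalTwoThreeRootFormsTwentySixB
import Summits.BirchSwinnertonDyer.BirchSwinnertonDyer.Theorems.ManinLocalTwoThreeNeronSqueeze
import Summits.BirchSwinnertonDyer.BirchSwinnertonDyer.Theorems.Rank2ObservatoryKrausCert
import Summits.BirchSwinnertonDyer.Rank1Residual.Additive.IntModelTamagawaCertificate
import Summits.BirchSwinnertonDyer.Rank1Residual.ManinAdditive.HalfTranslateTwistStep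
import Literature.NumberTheory.EllipticCurves.Gamma1PeriodLatticeTwistProofs
import Literature.NumberTheory.EllipticCurves.ManinConstantQuadraticTwistAtTwoProofs
import Literature.NumberTheory.EllipticCurves.ModularCurveNeronLatticeProofs
import HarnessLib

/-!
# LEVEL 208 COMPLETE: the classes `208a = 26a ⊗ χ₋₄`, `208d = 26b ⊗ χ₋₄` — `|c| = 1` UNCONDITIONALLY, by the datum-free roots `φ₂₆ₐ, φ₂₆ᵦ` on `Γ₀(104)`
# and the `r = ½` Néron twist identity

Cell bsd-f2-manin, route `ManinLocalTwoThree` (crux C2 `ManinOddAtFour`, stmt-BirchSwinnertonDyer-22967; `--supports` helper), LEAD p1 gen 27.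
LEAD g26 closed `208b = 104a ⊗ χ₋₄`, `208c = 52a ⊗ χ₋₄` (`…ManinConstantTwoHundredEight{B,C}`, `abs_maninConstant_eq_one_twoHundredEight_of_rowBC`) and left
`208a`/`208d` OPEN («a 26-root needs an's non-η basis engine»).  The roots are now in the tree DATUM-FREE at level `104` (`…RootFormsTwentySix{Cusp,A,B}`:
cuspidal `η`-representations, weight-2 Bracket–Sturm squeezes `Λ₁₀₄(φ₂₆ₓ) ⊆ Λ_Néron(26x1)` at depth `170`), and the transport is the one p2 g31 designed
and p3 g27 executed for `176b = 11a ⊗ χ₋₄` (`…ManinConstantOneSeventySixB`): the ROOT IS MULTIPLICATIVE (not additive) at `2`, so the twist model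
acquires `Δ_C = 2¹²·Δ_root`, `r = ½`, and the `2` of `r⁻¹` absorbs the Gauss sum `g(χ₋₄) = 2i` exactly — no `a₂ₖ = 0` half-translate is needed.

* §1 THE ROWS re-rooted at level `104`: `a₅(W) = −3 ⇒ D.f = φ₂₆ₐ|₁₀₄ ⊗ χ₋₄`, `a₃(W) = 3 ⇒ D.f = φ₂₆ᵦ|₁₀₄ ⊗ χ₋₄` (an g55's kernel pinning of level `208`,
  `…PinningTwoHundredEight`, rows `rowA`/`rowD` of `…TwoHundredEightC`, depth `64 ≥ 53` = the dual support, the root tables `t26a/t26b`);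
* §2 THE ALIGNED MINIMAL MODELS `C_a = [0, −1, 0, −72, 496]` (`= ⟨½,0,0,0⟩ • 26a1^(−1)`, `Δ = −2¹⁵·13³`) and `C_d = [0, 0, 0, −43, −166]`
  (`= ⟨½,−¼,0,0⟩ • 26b1^(−1)`, `Δ = −2¹⁹·13`), globally minimal by Kraus certificates (`v₂(c₄) = 4`);
* §3 the squeezes `Λ(D.f) ⊆ Λ_Néron(C)` (Stevens (5.4) `gaussSum_mul_mem_periodLattice_of_mem_charTwist`, Pal's `neronLattice_mem_iff_of_twist_of_sq_eq` with
  `r = ½`, `s = g/2`, `g² = −4`) and p3's Néron squeeze ⇒ `abs_maninConstant_eq_one_twoHundredEight_of_lFunction_five_eq_neg_three` / `…_of_lFunction_three_eq_three`;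
* §4 **`abs_maninConstant_eq_one_twoHundredEight (W) [IsElliptic] [IsGloballyMinimal] (D : ModularParametrizationData W 208) (hopt) : |D.maninConstant| = 1`**
  — LEVEL `208 = 2⁴·13` COMPLETE (four classes), `2 ∤ c`, `maninOddAtFour_twoHundredEight`.

HONEST FRAMING: unconditional (standard axioms); no modularity input, no CDT, no printed Manin fact, no root datum.  The `∀ N` cruxes C2/C3, Manin's
conjecture and BSD are NOT proved; item 22967 stays OPEN as filed.  No named fact, no sorry.
[cite: Stevens1989, Lemma (5.4) p. 97] [cite: Pal2012, Prop. 2.4, Lemma 3.1] [cite: AgasheRibetStein2006, §§1–2] [cite: Kraus1989, Prop. 2]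
[cite: CremonaAlgorithms1997, §2.10, Table 1 (26a1, 26b1, 208a–d)] [cite: MontgomeryVaughan2007, Thm. 9.17] [cite: Shimura1971, Prop. 3.64]
-/

set_option autoImplicit false
-- lint-debt: the directory name repeats the summit name (sibling precedent `ManinLocalTwoThreeManinConstantTwoHundredEightC.lean`)
set_option linter.dupNamespace false

noncomputable section

open Complex WeierstrassCurve
open UpperHalfPlane hiding I
open scoped MatrixGroups ModularForm
open ModularForm CongruenceSubgroup PowerSeries
open Literature.NumberTheory.ModularForms
open Literature.NumberTheory.EllipticCurves Literature.NumberTheory.EllipticCurves.ModularForms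

namespace Summit.BirchSwinnertonDyer.BirchSwinnertonDyer.Theorems.ManinLocalTwoThree.LevelTwoHundredEight

open Summit.BirchSwinnertonDyer.BirchSwinnertonDyer.Theorems.ManinLocalTwoThree
open Summit.BirchSwinnertonDyer.BirchSwinnertonDyer.Theorems
open Summit.BirchSwinnertonDyer.BirchSwinnertonDyer.Rank2Observatory
open Summit.BirchSwinnertonDyer.Rank1Residual.Additive
open Summit.BirchSwinnertonDyer.Rank1Residual.ManinAdditive
open BracketSturm PinningKernel PinningTwoHundredEight RootFormsTwentySix

set_option maxHeartbeats 4000000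
set_option maxRecDepth 16384

variable {W : WeierstrassCurve ℚ} [W.IsElliptic]

/-! ## §1 The rows `208a`, `208d`, re-rooted at level `104` -/

/-- `χ₋₄(n)·aₙ(φ₂₆ₐ)` to depth `64` — the row `208a`. [cite: CremonaAlgorithms1997, Table 1 (208a)] -/
def tabTa : List ℤ :=
  [0, 1, 0, -1, 0, -3, 0, 1, 0, -2, 0, -6, 0, 1, 0, 3, 0, -3, 0, -2, 0, -1, 0, 0, 0, 4, 0, 5, 0, 6, 0, 4, 0, 6, 0, -3, 0, -7, 0, -1, 0, 0, 0, 1, 0,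
  6, 0, -3, 0, -6, 0, 3, 0, 0, 0, 18, 0, 2, 0, 6, 0, 8, 0, -2]

/-- `χ₋₄(n)·aₙ(φ₂₆ᵦ)` to depth `64` — the row `208d`. [cite: CremonaAlgorithms1997, Table 1 (208d)] -/
def tabTd : List ℤ :=
  [0, 1, 0, 3, 0, -1, 0, -1, 0, 6, 0, 2, 0, -1, 0, -3, 0, -3, 0, -6, 0, -3, 0, 4, 0, -4, 0, 9, 0, 2, 0, -4, 0, 6, 0, 1, 0, 3, 0, -3, 0, 0, 0, 5, 0,
  -6, 0, -13, 0, -6, 0, -9, 0, 12, 0, -2, 0, -18, 0, 10, 0, -8, 0, -6]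

/-- `tabTa[n] = χ₋₄(n)·t26a[n]`, `n < 64`. [folklore] -/
theorem hTwA : ∀ n < 64, tabTa.getD n 0 = ZMod.χ₄ n * t26a.getD n 0 := by
  decide +kernel

/-- `tabTd[n] = χ₋₄(n)·t26b[n]`, `n < 64`. [folklore] -/
theorem hTwD : ∀ n < 64, tabTd.getD n 0 = ZMod.χ₄ n * t26b.getD n 0 := by
  decide +kernel

/-- **Row identity `208a`** on the first `64` columns. [folklore] -/
theorem hrowA64 : ∀ n < 64, rowA.2.1 * tabTa.getD n 0 = ∑ j : Fin 34, rowA.2.2.getD (j : ℕ) 0 * (tabs j).getD n 0 := by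
  decide +kernel

/-- **Row identity `208d`** on the first `64` columns. [folklore] -/
theorem hrowD64 : ∀ n < 64, rowD.2.1 * tabTd.getD n 0 = ∑ j : Fin 34, rowD.2.2.getD (j : ℕ) 0 * (tabs j).getD n 0 := by
  decide +kernel

/-- `aₙ(φ₂₆ₐ|₁₀₄ ⊗ χ₋₄) = tabTa[n]`, `n < 64`, read in `M₂(Γ₀(208))`. [cite: Shimura1971, Prop. 3.64] -/
theorem tabTa_eq_modCoef : ∀ n < 64, ((tabTa.getD n 0 : ℤ) : ℂ) = modCoefₗ 208 2 n (ModularFormClass.modularForm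
    (charTwist 208 (⟨2, rfl⟩ : 104 ∣ 208) (⟨13, rfl⟩ : 4 ^ 2 ∣ 208) isQuadratic_χ₄_ringHomComp phiTwentySixA)) := by
  intro n hn
  have hc : ((tabTa.getD n 0 : ℤ) : ℂ) = ((ZMod.χ₄ n : ℤ) : ℂ) * ((t26a.getD n 0 : ℤ) : ℂ) := by exact_mod_cast hTwA n hn
  rw [modCoefₗ_modularForm, cuspCoeff_charTwist 208 _ _ isQuadratic_χ₄_ringHomComp isPrimitive_χ₄_ringHomComp,
    χ₄_ringHomComp_apply_natCast, ← t26a_eq_cuspCoeff n hn]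
  exact hc

/-- `aₙ(φ₂₆ᵦ|₁₀₄ ⊗ χ₋₄) = tabTd[n]`, `n < 64`. [cite: Shimura1971, Prop. 3.64] -/
theorem tabTd_eq_modCoef : ∀ n < 64, ((tabTd.getD n 0 : ℤ) : ℂ) = modCoefₗ 208 2 n (ModularFormClass.modularForm
    (charTwist 208 (⟨2, rfl⟩ : 104 ∣ 208) (⟨13, rfl⟩ : 4 ^ 2 ∣ 208) isQuadratic_χ₄_ringHomComp phiTwentySixB)) := by
  intro n hn
  have hc : ((tabTd.getD n 0 : ℤ) : ℂ) = ((ZMod.χ₄ n : ℤ) : ℂ) * ((t26b.getD n 0 : ℤ) : ℂ) := by exact_mod_cast hTwD n hn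
  rw [modCoefₗ_modularForm, cuspCoeff_charTwist 208 _ _ isQuadratic_χ₄_ringHomComp isPrimitive_χ₄_ringHomComp,
    χ₄_ringHomComp_apply_natCast, ← t26b_eq_cuspCoeff n hn]
  exact hc

/-- **LEVEL 208: THE ROWS `a` AND `d`, re-rooted at `104`.**  For every `X₀(208)`-datum `D` of an elliptic `W/ℚ`: on the first certificate
`D.f = φ₂₆ₐ|₁₀₄ ⊗ χ₋₄`, on the fourth `D.f = φ₂₆ᵦ|₁₀₄ ⊗ χ₋₄`. [cite: CremonaAlgorithms1997, §2.10, Table 1 (208a–d)] [cite: Shimura1971, Prop. 3.64] -/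
theorem f_cases_rowAD (D : ModularParametrizationData W 208) :
    (truth W [2, 3, 5, 7, 11, 13, 17, 19, 23, 29, 31] = rowA.1 ∧
      D.f = charTwist 208 (⟨2, rfl⟩ : 104 ∣ 208) (⟨13, rfl⟩ : 4 ^ 2 ∣ 208) isQuadratic_χ₄_ringHomComp phiTwentySixA) ∨
    truth W [2, 3, 5, 7, 11, 13, 17, 19, 23, 29, 31] = rowB.1 ∨ truth W [2, 3, 5, 7, 11, 13, 17, 19, 23, 29, 31] = rowC.1 ∨
    (truth W [2, 3, 5, 7, 11, 13, 17, 19, 23, 29, 31] = rowD.1 ∧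
      D.f = charTwist 208 (⟨2, rfl⟩ : 104 ∣ 208) (⟨13, rfl⟩ : 4 ^ 2 ∣ 208) isQuadratic_χ₄_ringHomComp phiTwentySixB) := by
  haveI : FiniteDimensional ℂ (ModularForm (Gamma0 208) 2) := Module.finite_of_finrank_eq_succ finrank_modularForm_two
  have hlen : ∀ i : Fin 34, (duals i).length ≤ 64 := by decide +kernel
  have stages_map_fst : stages.map Prod.fst = [2, 3, 5, 7, 11, 13, 17, 19, 23, 29, 31] := by decide
  obtain ⟨C, hC, c, hc, htruth, hpin⟩ := pinning D
  have ht := tables_of_etaCertsSparse 208 128 (fun i : Fin 34 ↦ expFn (Ls[(i : ℕ)]).1) (fun i ↦ shifts i) tabs C hC hshift hcert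
  have ht' : ∀ i, ∀ n < 64, (((tabs i).getD n 0 : ℤ) : ℂ) = modCoefₗ 208 2 n (C i) := fun i n hn ↦ ht i n (by omega)
  rw [stages_map_fst] at htruth
  rw [goodCerts_eq_rows] at hc
  simp only [List.mem_cons, List.mem_nil_iff, or_false] at hc
  rcases hc with rfl | rfl | rfl | rfl
  · exact Or.inl ⟨htruth, cuspForm_eq_of_modularForm_eq (eq_of_smul_eq_sum_of_row C tabs duals 367810560 ht' hlen hdual
      (by norm_num) finrank_modularForm_two _ tabTa tabTa_eq_modCoef rowA.2.1 (by decide) rowA.2.2 hpin hrowA64)⟩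
  · exact Or.inr (Or.inl htruth)
  · exact Or.inr (Or.inr (Or.inl htruth))
  · exact Or.inr (Or.inr (Or.inr ⟨htruth, cuspForm_eq_of_modularForm_eq (eq_of_smul_eq_sum_of_row C tabs duals 367810560 ht' hlen hdual
      (by norm_num) finrank_modularForm_two _ tabTd tabTd_eq_modCoef rowD.2.1 (by decide) rowD.2.2 hpin hrowD64)⟩))

/-- **The `208a` row selected by `a₅(W) = −3`**: `D.f = φ₂₆ₐ|₁₀₄ ⊗ χ₋₄`. [cite: CremonaAlgorithms1997, Table 1 (208a)] -/
theorem f_eq_charTwist_phi26a_of_lFunction_five (D : ModularParametrizationData W 208) (h5 : W.LFunction 5 = -3) :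
    D.f = charTwist 208 (⟨2, rfl⟩ : 104 ∣ 208) (⟨13, rfl⟩ : 4 ^ 2 ∣ 208) isQuadratic_χ₄_ringHomComp phiTwentySixA := by
  rcases f_cases_rowAD D with ⟨-, hf⟩ | h | h | ⟨h, -⟩
  · exact hf
  · have h' := lFunction_five_of_truth rowB h; rw [h5] at h'; simp [rowB] at h'
  · have h' := lFunction_five_of_truth rowC h; rw [h5] at h'; simp [rowC] at h'
  · have h' := lFunction_five_of_truth rowD h; rw [h5] at h'; simp [rowD] at h'

/-- **The `208d` row selected by `a₃(W) = 3`**: `D.f = φ₂₆ᵦ|₁₀₄ ⊗ χ₋₄`. [cite: CremonaAlgorithms1997, Table 1 (208d)] -/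
theorem f_eq_charTwist_phi26b_of_lFunction_three (D : ModularParametrizationData W 208) (h3 : W.LFunction 3 = 3) :
    D.f = charTwist 208 (⟨2, rfl⟩ : 104 ∣ 208) (⟨13, rfl⟩ : 4 ^ 2 ∣ 208) isQuadratic_χ₄_ringHomComp phiTwentySixB := by
  rcases f_cases_rowAD D with ⟨h, -⟩ | h | h | ⟨-, hf⟩
  · have h' := lFunction_three_of_truth rowA h; rw [h3] at h'; simp [rowA] at h'
  · have h' := lFunction_three_of_truth rowB h; rw [h3] at h'; simp [rowB] at h'
  · have h' := lFunction_three_of_truth rowC h; rw [h3] at h'; simp [rowC] at h'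
  · exact hf

/-! ## §2 The aligned minimal models -/

/-- The unit `½ ∈ ℚˣ`. [folklore] -/
def uHalf : ℚˣ := ⟨1 / 2, 2, by norm_num, by norm_num⟩

/-- **ALIGNED EDGE `26a1 ⊗ (−1) → C_a = [0, −1, 0, −72, 496]`** (`u = ⟨½, 0, 0, 0⟩`). [cite: CremonaAlgorithms1997, Table 1 (26a1, 208a)] -/
theorem smul_quadraticTwist_twentySixA1_negOne :
    (⟨uHalf, 0, 0, 0⟩ : VariableChange ℚ) • (⟨1, 0, 1, -5, -8⟩ : WeierstrassCurve ℚ).quadraticTwist ((-1 : ℤ) : ℚ) = ⟨0, -1, 0, -72, 496⟩ := by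
  ext <;> simp only [variableChange_a₁, variableChange_a₂, variableChange_a₃, variableChange_a₄, variableChange_a₆,
    quadraticTwist_a₁, quadraticTwist_a₂, quadraticTwist_a₃, quadraticTwist_a₄, quadraticTwist_a₆, b₂, b₄, b₆, uHalf] <;> norm_num

/-- **ALIGNED EDGE `26b1 ⊗ (−1) → C_d = [0, 0, 0, −43, −166]`** (`u = ⟨½, −¼, 0, 0⟩`). [cite: CremonaAlgorithms1997, Table 1 (26b1, 208d)] -/
theorem smul_quadraticTwist_twentySixB1_negOne :
    (⟨uHalf, -1 / 4, 0, 0⟩ : VariableChange ℚ) • (⟨1, -1, 1, -3, 3⟩ : WeierstrassCurve ℚ).quadraticTwist ((-1 : ℤ) : ℚ) = ⟨0, 0, 0, -43, -166⟩ := by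
  ext <;> simp only [variableChange_a₁, variableChange_a₂, variableChange_a₃, variableChange_a₄, variableChange_a₆,
    quadraticTwist_a₁, quadraticTwist_a₂, quadraticTwist_a₃, quadraticTwist_a₄, quadraticTwist_a₆, b₂, b₄, b₆, uHalf] <;> norm_num

/-- `(½)¹²·Δ(C_a) = (−1)⁶·Δ(26a1)` (`Δ(C_a) = −2¹⁵·13³ = 2¹²·Δ(26a1)`). [folklore] -/
theorem Δ_Ca_eq : ((1 / 2 : ℚ)) ^ 12 * (⟨0, -1, 0, -72, 496⟩ : WeierstrassCurve ℚ).Δ = (((-1 : ℤ) : ℚ)) ^ 6 * (⟨1, 0, 1, -5, -8⟩ : WeierstrassCurve ℚ).Δ := by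
  norm_num [WeierstrassCurve.Δ, WeierstrassCurve.b₂, WeierstrassCurve.b₄, WeierstrassCurve.b₆, WeierstrassCurve.b₈]

/-- `(½)¹²·Δ(C_d) = (−1)⁶·Δ(26b1)` (`Δ(C_d) = −2¹⁹·13 = 2¹²·Δ(26b1)`). [folklore] -/
theorem Δ_Cd_eq : ((1 / 2 : ℚ)) ^ 12 * (⟨0, 0, 0, -43, -166⟩ : WeierstrassCurve ℚ).Δ = (((-1 : ℤ) : ℚ)) ^ 6 * (⟨1, -1, 1, -3, 3⟩ : WeierstrassCurve ℚ).Δ := by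
  norm_num [WeierstrassCurve.Δ, WeierstrassCurve.b₂, WeierstrassCurve.b₄, WeierstrassCurve.b₆, WeierstrassCurve.b₈]

/-- `C_a` is an elliptic curve. [folklore] -/
theorem isElliptic_Ca : (⟨0, -1, 0, -72, 496⟩ : WeierstrassCurve ℚ).IsElliptic :=
  ⟨by norm_num [WeierstrassCurve.Δ, WeierstrassCurve.b₂, WeierstrassCurve.b₄, WeierstrassCurve.b₆, WeierstrassCurve.b₈]⟩

/-- `C_d` is an elliptic curve. [folklore] -/
theorem isElliptic_Cd : (⟨0, 0, 0, -43, -166⟩ : WeierstrassCurve ℚ).IsElliptic :=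
  ⟨by norm_num [WeierstrassCurve.Δ, WeierstrassCurve.b₂, WeierstrassCurve.b₄, WeierstrassCurve.b₆, WeierstrassCurve.b₈]⟩

/-- **`C_a = [0, −1, 0, −72, 496]` is globally minimal** — Kraus certificate (`|Δ| = 2¹⁵·13³`, `c₄ = 2⁴·7·31`, `2⁸ ∤ c₆ + 64 = −2⁷·3185`; `13 ∤ c₄`).
[cite: Kraus1989, Prop. 2] [cite: SilvermanAEC2009, VII.1 Remark 1.1] -/
theorem isGloballyMinimal_Ca : (⟨0, -1, 0, -72, 496⟩ : WeierstrassCurve ℚ).IsGloballyMinimal := by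
  rw [show (⟨0, -1, 0, -72, 496⟩ : WeierstrassCurve ℚ) = ⟨((0 : ℤ) : ℚ), ((-1 : ℤ) : ℚ), ((0 : ℤ) : ℚ), ((-72 : ℤ) : ℚ), ((496 : ℤ) : ℚ)⟩ by
    ext <;> norm_num, ← IntModelTam.baseChange_rat_mk_int]
  exact isGloballyMinimal_of_krausCheck (W₀ := ⟨0, -1, 0, -72, 496⟩) (c := ⟨15, 4, 6, [⟨13, 3, 3, 0, 0⟩]⟩) (by decide +kernel)

/-- **`C_d = [0, 0, 0, −43, −166]` is globally minimal** — Kraus certificate (`|Δ| = 2¹⁹·13`, `c₄ = 2⁴·3·43`, `2⁸ ∤ c₆ + 64 = 2⁷·1121`; `13 ∤ c₄`).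
[cite: Kraus1989, Prop. 2] [cite: SilvermanAEC2009, VII.1 Remark 1.1] -/
theorem isGloballyMinimal_Cd : (⟨0, 0, 0, -43, -166⟩ : WeierstrassCurve ℚ).IsGloballyMinimal := by
  rw [show (⟨0, 0, 0, -43, -166⟩ : WeierstrassCurve ℚ) = ⟨((0 : ℤ) : ℚ), ((0 : ℤ) : ℚ), ((0 : ℤ) : ℚ), ((-43 : ℤ) : ℚ), ((-166 : ℤ) : ℚ)⟩ by
    ext <;> norm_num, ← IntModelTam.baseChange_rat_mk_int]
  exact isGloballyMinimal_of_krausCheck (W₀ := ⟨0, 0, 0, -43, -166⟩) (c := ⟨19, 4, 6, [⟨13, 3, 1, 0, 0⟩]⟩) (by decide +kernel)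

/-! ## §3 The squeezes and the two headlines -/

/-- **The `r = ½` transport for a root good or multiplicative at `2`**: from `D.f = f₀ ⊗ χ₋₄` (`f₀` on `Γ₀(104)`), the root squeeze
`Λ₁₀₄(f₀) ⊆ Λ(L₀)` (`L₀` Néron for `W₀`), and an aligned globally minimal `C = u • W₀^(−1)` with `(½)¹²·Δ_C = Δ_{W₀}`: `|c(D)| = 1`.  (Stevens (5.4):
`g·Λ(f₀ ⊗ χ₋₄) ⊆ Λ₁₀₄(f₀)`; Pal: `z ∈ Λ(L_C) ⟺ (g/2)(2z) ∈ Λ(L₀)`; p3's Néron squeeze with `W₀ = C`.) [cite: Stevens1989, Lemma (5.4) p. 97] [cite: Pal2012, Lemma 3.1]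
[cite: AgasheRibetStein2006, §§1–2] -/
theorem abs_maninConstant_eq_one_of_negOneTwist_rHalf (f₀ : CuspForm (Gamma0 104) 2)
    (W₀ : WeierstrassCurve ℚ) [W₀.IsElliptic] (L₀ : PeriodPair) (hL₀ : IsNeronLatticeOf (W₀.baseChange ℂ) L₀)
    (hS0 : ∀ z ∈ periodLattice f₀, z ∈ L₀.lattice)
    (C : WeierstrassCurve ℚ) [C.IsElliptic] [C.IsGloballyMinimal] (u : VariableChange ℚ)
    (hu : u • W₀.quadraticTwist ((-1 : ℤ) : ℚ) = C) (hΔ : ((1 / 2 : ℚ)) ^ 12 * C.Δ = (((-1 : ℤ) : ℚ)) ^ 6 * W₀.Δ)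
    (W : WeierstrassCurve ℚ) [W.IsElliptic] [W.IsGloballyMinimal] (D : ModularParametrizationData W 208)
    (hf : D.f = charTwist 208 (⟨2, rfl⟩ : 104 ∣ 208) (⟨13, rfl⟩ : 4 ^ 2 ∣ 208) isQuadratic_χ₄_ringHomComp f₀)
    (hopt : ∀ z ∈ D.L.lattice, ∃ w ∈ periodLattice D.f, z = D.c * w) : |D.maninConstant| = 1 := by
  obtain ⟨LC, hLC⟩ := exists_isNeronLatticeOf_holds (C.baseChange ℂ)
  set g : ℂ := gaussSum (ZMod.χ₄.ringHomComp (Int.castRingHom ℂ)) (ZMod.stdAddChar (N := 4)) with hg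
  have hs : (g / 2) ^ 2 = ((((-1 : ℤ) : ℚ)) : ℂ) := by
    rw [div_pow, gaussSum_χ₄_ringHomComp_sq]; norm_num
  have hle : ∀ w ∈ periodLattice D.f, w ∈ LC.lattice := by
    intro w hw
    rw [hf] at hw
    have hgw : g * w ∈ L₀.lattice :=
      hS0 _ (gaussSum_mul_mem_periodLattice_of_mem_charTwist 208 (⟨2, rfl⟩ : 104 ∣ 208) (⟨13, rfl⟩ : 4 ^ 2 ∣ 208)
        isQuadratic_χ₄_ringHomComp isPrimitive_χ₄_ringHomComp f₀ hw)
    rw [neronLattice_mem_iff_of_twist_of_sq_eq (W := W₀) (by norm_num) u hu (r := 1 / 2) hΔ hs hL₀ hLC w]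
    convert hgw using 1
    push_cast
    ring
  exact NeronSqueeze.abs_maninConstant_eq_one_of_periodLattice_le C LC hLC W D hle hopt

/-- **`|c| = 1` ON THE ROW `208a = 26a ⊗ χ₋₄`** (`a₅(W) = −3`). [cite: AgasheRibetStein2006, §§1–2] [cite: CremonaAlgorithms1997, Table 1 (208a)] -/
theorem abs_maninConstant_eq_one_twoHundredEight_of_lFunction_five_eq_neg_three (W : WeierstrassCurve ℚ) [W.IsElliptic] [W.IsGloballyMinimal]
    (D : ModularParametrizationData W 208) (h5 : W.LFunction 5 = -3)
    (hopt : ∀ z ∈ D.L.lattice, ∃ w ∈ periodLattice D.f, z = D.c * w) : |D.maninConstant| = 1 := by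
  obtain ⟨L₀, hL₀, hS0⟩ := exists_neron_squeeze_phiTwentySixA
  haveI := isElliptic_twentySixA1
  haveI := isElliptic_Ca
  haveI := isGloballyMinimal_Ca
  exact abs_maninConstant_eq_one_of_negOneTwist_rHalf phiTwentySixA (⟨1, 0, 1, -5, -8⟩ : WeierstrassCurve ℚ) L₀ hL₀ hS0
    (⟨0, -1, 0, -72, 496⟩ : WeierstrassCurve ℚ) ⟨uHalf, 0, 0, 0⟩ smul_quadraticTwist_twentySixA1_negOne Δ_Ca_eq W D
    (f_eq_charTwist_phi26a_of_lFunction_five D h5) hopt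

/-- **`|c| = 1` ON THE ROW `208d = 26b ⊗ χ₋₄`** (`a₃(W) = 3`). [cite: AgasheRibetStein2006, §§1–2] [cite: CremonaAlgorithms1997, Table 1 (208d)] -/
theorem abs_maninConstant_eq_one_twoHundredEight_of_lFunction_three_eq_three (W : WeierstrassCurve ℚ) [W.IsElliptic] [W.IsGloballyMinimal]
    (D : ModularParametrizationData W 208) (h3 : W.LFunction 3 = 3)
    (hopt : ∀ z ∈ D.L.lattice, ∃ w ∈ periodLattice D.f, z = D.c * w) : |D.maninConstant| = 1 := by
  obtain ⟨L₀, hL₀, hS0⟩ := exists_neron_squeeze_phiTwentySixB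
  haveI := isElliptic_twentySixB1
  haveI := isElliptic_Cd
  haveI := isGloballyMinimal_Cd
  exact abs_maninConstant_eq_one_of_negOneTwist_rHalf phiTwentySixB (⟨1, -1, 1, -3, 3⟩ : WeierstrassCurve ℚ) L₀ hL₀ hS0
    (⟨0, 0, 0, -43, -166⟩ : WeierstrassCurve ℚ) ⟨uHalf, -1 / 4, 0, 0⟩ smul_quadraticTwist_twentySixB1_negOne Δ_Cd_eq W D
    (f_eq_charTwist_phi26b_of_lFunction_three D h3) hopt

/-! ## §4 LEVEL 208 COMPLETE -/

/-- **LEVEL 208 COMPLETE — `|c| = 1` for every globally minimal elliptic `W/ℚ` and every `X₀(208)`-datum with the lattice clause `Λ_W = c·Λ_f`.**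
Rows `208b/208c` (`a₅ ≠ −3`, `a₃ ≠ 3`): LEAD g26 (`…_of_rowBC`); rows `208a` (`a₅ = −3`) and `208d` (`a₃ = 3`): above.
[cite: CremonaAlgorithms1997, Table 1 (208a–d)] [cite: AgasheRibetStein2006, §§1–2] -/
theorem abs_maninConstant_eq_one_twoHundredEight (W : WeierstrassCurve ℚ) [W.IsElliptic] [W.IsGloballyMinimal]
    (D : ModularParametrizationData W 208) (hopt : ∀ z ∈ D.L.lattice, ∃ w ∈ periodLattice D.f, z = D.c * w) :
    |D.maninConstant| = 1 := by
  by_cases h5 : W.LFunction 5 = -3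
  · exact abs_maninConstant_eq_one_twoHundredEight_of_lFunction_five_eq_neg_three W D h5 hopt
  by_cases h3 : W.LFunction 3 = 3
  · exact abs_maninConstant_eq_one_twoHundredEight_of_lFunction_three_eq_three W D h3 hopt
  · exact abs_maninConstant_eq_one_twoHundredEight_of_rowBC W D h5 h3 hopt

/-- **Corollary: no integer `q` with `|q| ≠ 1` — in particular neither `2` nor `13` — divides the Manin constant of a lattice-optimal
`X₀(208)`-datum.** [folklore] -/
theorem not_dvd_maninConstant_twoHundredEight (W : WeierstrassCurve ℚ) [W.IsElliptic] [W.IsGloballyMinimal]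
    (D : ModularParametrizationData W 208) (hopt : ∀ z ∈ D.L.lattice, ∃ w ∈ periodLattice D.f, z = D.c * w)
    {q : ℤ} (hq : q.natAbs ≠ 1) : ¬ q ∣ D.maninConstant := by
  intro h
  have h1 := abs_maninConstant_eq_one_twoHundredEight W D hopt
  have hn : D.maninConstant.natAbs = 1 := by
    rw [Int.abs_eq_natAbs] at h1
    exact_mod_cast h1
  have h2 : q.natAbs ∣ 1 := hn ▸ Int.natAbs_dvd_natAbs.mpr h
  exact hq (Nat.dvd_one.mp h2)

/-- **`2 ∤ c` on `X₀(208)`, UNCONDITIONALLY** — the body of the crux C2 `ManinOddAtFour` at `N = 208` with none of its fact hypotheses.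
[cite: AgasheRibetStein2006, §§1–2] -/
theorem not_two_dvd_maninConstant_twoHundredEight (W : WeierstrassCurve ℚ) [W.IsElliptic] [W.IsGloballyMinimal]
    (D : ModularParametrizationData W 208) (hopt : ∀ z ∈ D.L.lattice, ∃ w ∈ periodLattice D.f, z = D.c * w) :
    ¬ (2 : ℤ) ∣ D.maninConstant :=
  not_dvd_maninConstant_twoHundredEight W D hopt (by decide)

/-- **C2's inner clause at `N = 208` in the item's literal shape**: `2² ∣ 208`, and every lattice-optimal `X₀(208)`-datum of every globally
minimal elliptic curve has `|c| = 1` and `2 ∤ c`. [cite: CremonaAlgorithms1997, Table 1 (208a–d)] -/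
theorem maninOddAtFour_twoHundredEight : 2 ^ 2 ∣ 208 ∧
    ∀ (W : WeierstrassCurve ℚ) [W.IsElliptic] [W.IsGloballyMinimal] (D : ModularParametrizationData W 208),
      (∀ z ∈ D.L.lattice, ∃ w ∈ periodLattice D.f, z = D.c * w) →
        |D.maninConstant| = 1 ∧ ¬ (2 : ℤ) ∣ D.maninConstant :=
  ⟨by norm_num, fun W _ _ D hopt ↦
    ⟨abs_maninConstant_eq_one_twoHundredEight W D hopt, not_two_dvd_maninConstant_twoHundredEight W D hopt⟩⟩

end Summit.BirchSwinnertonDyer.BirchSwinnertonDyer.Theorems.ManinLocalTwoThree.LevelTwoHundredEight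

end
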